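import Literature.Dynamics.SymbolicDynamics.Hochman2025SafePoints
import Literature.Dynamics.SymbolicDynamics.Hochman2025SafePaths
import HarnessLib

/-!
# Hochman 2025, §4: safe points lie on safe flat paths (Prop. 4.9 (4), Prop. 4.1 (3))

The path assertion of Prop. 4.1/4.9 of M. Hochman, *Irreducibility and periodicity in `ℤ²`
symbolic systems* (Discrete Analysis 2025:17), for the envelope hull of
`Hochman2025SafePoints.lean`: every safe point `p` lies on the graph of a `β₀`-Lipschitz function
`f : ℝ → ℝ` (`β₀ = b₀/a₀`, the slope of the smallest diamonds — Hochman's `α₁ = h₁/w₁`) all of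
whose points are safe (`SafePoints.exists_safe_path`). The hull is presented as a finite family
of pairwise disjoint blobs (`Hochman2025SafePaths.lean`): for each root `D` the support of the
envelope of its clan `S` is the finite union of the compact intervals
`{x | floor_E x ≤ roof_{E'} x}`, `E, E' ∈ S`, merged into components, and over each component the
piece is the blob between the lower envelope of the floors and the upper envelope of the roofs;
distinct root pieces are disjoint by `SafePoints.sep_of_isRoot`. Then `SafePaths.exists_path`
applies. All distances are in the sup-metric of `ℝ × ℝ`.

Finally Prop. 4.1 itself is assembled for families of rectilinear rectangles (§4.5): with
`RectScales` (widths `w n`, heights `h n`), the associated diamonds `◇(2R)` (`RectScales.toScales`: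
half-width `2 w`, half-height `2 h`), scaled rectangles `Diamond.rect`, and `RectSparse`
(centres of distinct same-level rectangles `≥ 42 w` apart horizontally or `≥ 42 h` vertically),
`SafePoints.prop_4_1` states the four assertions of Prop. 4.1 for the safe set of the
associated diamond family: sandwich (between `ℝ² ∖ ⋃ 8R` and `ℝ² ∖ ⋃ 2R`), vertical segments
of length `8 h_N`, safe `(h₀/w₀)`-Lipschitz paths, and locality/agreement (at scale `76 R`).

## References

* [Hochman2025] M. Hochman, *Irreducibility and periodicity in `ℤ²` symbolic systems*, Discrete
  Analysis 2025:17, Prop. 4.1 (3) and Prop. 4.9 (4) (pp. 11–16). Read via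
  `lit read arxiv:2401.02273`.
-/

noncomputable section

open Set
open scoped Classical NNReal

namespace Literature.Dynamics.SymbolicDynamics

namespace Hochman2025

namespace SafePoints

variable {σ : Scales}

/-! ### Roofs and floors are Lipschitz; the envelopes as functions -/

/-- A roof is Lipschitz with constant its slope. [folklore] -/
theorem Diamond.roof_lip (E : Diamond) (x y : ℝ) :
    |E.roof σ x - E.roof σ y| ≤ σ.β E.n * |x - y| := by
  simp only [Diamond.roof]
  rw [show E.c.2 + σ.b E.n - σ.β E.n * |x - E.c.1| - (E.c.2 + σ.b E.n - σ.β E.n * |y - E.c.1|)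
    = σ.β E.n * (|y - E.c.1| - |x - E.c.1|) by ring, abs_mul, abs_of_pos (σ.β_pos E.n)]
  refine mul_le_mul_of_nonneg_left ?_ (σ.β_pos E.n).le
  rw [abs_sub_comm x y]
  exact abs_abs_sub_abs_le_abs_sub _ _ |>.trans (by rw [show y - E.c.1 - (x - E.c.1) = y - x by ring])

/-- A floor is Lipschitz with constant its slope. [folklore] -/
theorem Diamond.floor_lip (E : Diamond) (x y : ℝ) :
    |E.floor σ x - E.floor σ y| ≤ σ.β E.n * |x - y| := by
  simp only [Diamond.floor]
  rw [show E.c.2 - σ.b E.n + σ.β E.n * |x - E.c.1| - (E.c.2 - σ.b E.n + σ.β E.n * |y - E.c.1|)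
    = σ.β E.n * (|x - E.c.1| - |y - E.c.1|) by ring, abs_mul, abs_of_pos (σ.β_pos E.n)]
  refine mul_le_mul_of_nonneg_left ?_ (σ.β_pos E.n).le
  exact abs_abs_sub_abs_le_abs_sub _ _ |>.trans (by rw [show x - E.c.1 - (y - E.c.1) = x - y by ring])

/-- All slopes are at most the slope of level `0`. [cite: Hochman2025, Prop 4.9 (c)] -/
theorem Scales.Good.β_le_β_zero {Λ : ℝ} (h : σ.Good Λ) (n : ℕ) : σ.β n ≤ σ.β 0 := by
  rcases Nat.eq_zero_or_pos n with rfl | hn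
  · exact le_rfl
  · have := h.β_lt_le hn
    linarith [σ.β_pos 0]

/-- The upper envelope of the roofs of a non-empty finite set of diamonds, as a function. [folklore] -/
def uroof (σ : Scales) (S : Finset Diamond) (hS : S.Nonempty) (x : ℝ) : ℝ :=
  S.sup' hS fun E => E.roof σ x

/-- The lower envelope of the floors. [folklore] -/
def lfloor (σ : Scales) (S : Finset Diamond) (hS : S.Nonempty) (x : ℝ) : ℝ :=
  S.inf' hS fun E => E.floor σ x

/-- Membership in the envelope through the envelope functions. [folklore] -/
theorem mem_env_iff_lfloor_uroof {S : Finset Diamond} (hS : S.Nonempty) {q : ℝ × ℝ} :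
    q ∈ env σ S ↔ lfloor σ S hS q.1 ≤ q.2 ∧ q.2 ≤ uroof σ S hS q.1 := by
  rw [mem_env, lfloor, uroof, Finset.inf'_le_iff, Finset.le_sup'_iff]

/-- The upper envelope is attained. [folklore] -/
theorem exists_uroof_eq {S : Finset Diamond} (hS : S.Nonempty) (x : ℝ) :
    ∃ E ∈ S, uroof σ S hS x = E.roof σ x :=
  Finset.exists_mem_eq_sup' hS _

/-- The lower envelope is attained. [folklore] -/
theorem exists_lfloor_eq {S : Finset Diamond} (hS : S.Nonempty) (x : ℝ) :
    ∃ E ∈ S, lfloor σ S hS x = E.floor σ x :=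
  Finset.exists_mem_eq_inf' hS _

/-- Roofs lie below the upper envelope. [folklore] -/
theorem roof_le_uroof {S : Finset Diamond} (hS : S.Nonempty) {E : Diamond} (hE : E ∈ S) (x : ℝ) :
    E.roof σ x ≤ uroof σ S hS x :=
  Finset.le_sup' (fun E => E.roof σ x) hE

/-- Floors lie above the lower envelope. [folklore] -/
theorem lfloor_le_floor {S : Finset Diamond} (hS : S.Nonempty) {E : Diamond} (hE : E ∈ S) (x : ℝ) :
    lfloor σ S hS x ≤ E.floor σ x :=
  Finset.inf'_le (fun E => E.floor σ x) hE

/-- The upper envelope is Lipschitz with any common bound `K` of the member slopes. [folklore] -/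
theorem uroof_lip {S : Finset Diamond} (hS : S.Nonempty) {K : ℝ} (hK : ∀ E ∈ S, σ.β E.n ≤ K)
    (x y : ℝ) : |uroof σ S hS x - uroof σ S hS y| ≤ K * |x - y| := by
  have key : ∀ x y, uroof σ S hS x ≤ uroof σ S hS y + K * |x - y| := by
    intro x y
    rw [uroof, Finset.sup'_le_iff]
    intro E hE
    have h1 := E.roof_lip (σ := σ) x y
    have h2 := roof_le_uroof (σ := σ) hS hE y
    have h3 : σ.β E.n * |x - y| ≤ K * |x - y| :=
      mul_le_mul_of_nonneg_right (hK E hE) (abs_nonneg _)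
    rw [abs_le] at h1
    linarith
  rw [abs_le]
  have h1 := key x y
  have h2 := key y x
  rw [abs_sub_comm y x] at h2
  constructor <;> linarith

/-- The lower envelope is Lipschitz with any common bound `K` of the member slopes. [folklore] -/
theorem lfloor_lip {S : Finset Diamond} (hS : S.Nonempty) {K : ℝ} (hK : ∀ E ∈ S, σ.β E.n ≤ K)
    (x y : ℝ) : |lfloor σ S hS x - lfloor σ S hS y| ≤ K * |x - y| := by
  have key : ∀ x y, lfloor σ S hS y - K * |x - y| ≤ lfloor σ S hS x := by
    intro x y
    rw [lfloor, lfloor, Finset.le_inf'_iff]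
    intro E hE
    have h1 := E.floor_lip (σ := σ) x y
    have h2 := lfloor_le_floor (σ := σ) hS hE y
    have h3 : σ.β E.n * |x - y| ≤ K * |x - y| :=
      mul_le_mul_of_nonneg_right (hK E hE) (abs_nonneg _)
    rw [abs_le] at h1
    rw [lfloor] at h2
    linarith
  rw [abs_le]
  have h1 := key x y
  have h2 := key y x
  rw [abs_sub_comm y x] at h2
  constructor <;> linarith


/-! ### The support intervals `{floor_E ≤ roof_{E'}}` -/

/-- The set of abscissae where the floor of `j.1` is below the roof of `j.2`: there the region
between them is a non-empty vertical segment of the envelope. [folklore] -/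
def jset (σ : Scales) (j : Diamond × Diamond) : Set ℝ := {x | j.1.floor σ x ≤ j.2.roof σ x}

/-- Membership in `jset`. [folklore] -/
theorem mem_jset {j : Diamond × Diamond} {x : ℝ} : x ∈ jset σ j ↔ j.1.floor σ x ≤ j.2.roof σ x :=
  Iff.rfl

/-- Floors are continuous. [folklore] -/
theorem Diamond.continuous_floor (E : Diamond) : Continuous fun x => E.floor σ x := by
  unfold Diamond.floor; fun_prop

/-- Roofs are continuous. [folklore] -/
theorem Diamond.continuous_roof (E : Diamond) : Continuous fun x => E.roof σ x := by
  unfold Diamond.roof; fun_prop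

/-- `jset` is closed. [folklore] -/
theorem isClosed_jset (j : Diamond × Diamond) : IsClosed (jset σ j) :=
  isClosed_le j.1.continuous_floor j.2.continuous_roof

/-- `jset` is bounded: within `h / β` of the centre abscissa of `j.1`, where `h` is the height of
the apex of `j.2` above the bottom of `j.1`. [folklore] -/
theorem jset_subset_Icc (j : Diamond × Diamond) :
    jset σ j ⊆ Icc (j.1.c.1 - (j.2.c.2 + σ.b j.2.n - (j.1.c.2 - σ.b j.1.n)) / σ.β j.1.n)
      (j.1.c.1 + (j.2.c.2 + σ.b j.2.n - (j.1.c.2 - σ.b j.1.n)) / σ.β j.1.n) := by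
  intro x hx
  rw [mem_jset, Diamond.floor, Diamond.roof] at hx
  have hβ := σ.β_pos j.1.n
  have hβ' := σ.β_pos j.2.n
  have h1 : σ.β j.1.n * |x - j.1.c.1| ≤ j.2.c.2 + σ.b j.2.n - (j.1.c.2 - σ.b j.1.n) := by
    nlinarith [abs_nonneg (x - j.2.c.1)]
  have h2 : |x - j.1.c.1| ≤ (j.2.c.2 + σ.b j.2.n - (j.1.c.2 - σ.b j.1.n)) / σ.β j.1.n := by
    rw [le_div_iff₀ hβ]; linarith
  rw [abs_le] at h2
  constructor <;> linarith [h2.1, h2.2]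

/-- `jset` is bounded below. [folklore] -/
theorem bddBelow_jset (j : Diamond × Diamond) : BddBelow (jset σ j) :=
  (bddBelow_Icc).mono (jset_subset_Icc j)

/-- `jset` is bounded above. [folklore] -/
theorem bddAbove_jset (j : Diamond × Diamond) : BddAbove (jset σ j) :=
  (bddAbove_Icc).mono (jset_subset_Icc j)

/-- `jset` is compact. [folklore] -/
theorem isCompact_jset (j : Diamond × Diamond) : IsCompact (jset σ j) :=
  isCompact_Icc.of_isClosed_subset (isClosed_jset j) (jset_subset_Icc j)

/-- Convexity of `|· - c|` along a segment, cleared of denominators. [folklore] -/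
theorem abs_comb_le (x y z c : ℝ) (hxz : x ≤ z) (hzy : z ≤ y) :
    (y - x) * |z - c| ≤ (y - z) * |x - c| + (z - x) * |y - c| := by
  have hid : (y - x) * (z - c) = (y - z) * (x - c) + (z - x) * (y - c) := by ring
  have h1 : (y - x) * |z - c| = |(y - x) * (z - c)| := by
    rw [abs_mul, abs_of_nonneg (by linarith : (0:ℝ) ≤ y - x)]
  rw [h1, hid]
  refine (abs_add_le _ _).trans (le_of_eq ?_)
  rw [abs_mul, abs_mul, abs_of_nonneg (by linarith : 0 ≤ y - z), abs_of_nonneg (by linarith : 0 ≤ z - x)]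

/-- `jset` is an interval (the function `floor_E - roof_{E'}` is convex). [folklore] -/
theorem jset_ordConnected (j : Diamond × Diamond) {x y z : ℝ} (hx : x ∈ jset σ j) (hy : y ∈ jset σ j)
    (hxz : x ≤ z) (hzy : z ≤ y) : z ∈ jset σ j := by
  rw [mem_jset, Diamond.floor, Diamond.roof] at hx hy ⊢
  rcases eq_or_lt_of_le (hxz.trans hzy) with hxy | hxy
  · have : z = x := le_antisymm (hxy ▸ hzy) hxz
    rw [this]; exact hx
  · have hβ := σ.β_pos j.1.n
    have hβ' := σ.β_pos j.2.n
    have h1 := abs_comb_le x y z j.1.c.1 hxz hzy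
    have h2 := abs_comb_le x y z j.2.c.1 hxz hzy
    -- `(y - x) φ(z) ≤ (y - z) φ(x) + (z - x) φ(y) ≤ 0`
    have key : (y - x) * (j.1.c.2 - σ.b j.1.n + σ.β j.1.n * |z - j.1.c.1|
        - (j.2.c.2 + σ.b j.2.n - σ.β j.2.n * |z - j.2.c.1|)) ≤ 0 := by
      nlinarith [mul_le_mul_of_nonneg_left h1 hβ.le, mul_le_mul_of_nonneg_left h2 hβ'.le,
        mul_nonneg (by linarith : (0:ℝ) ≤ y - z) (by linarith : (0:ℝ) ≤ j.2.c.2 + σ.b j.2.n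
          - σ.β j.2.n * |x - j.2.c.1| - (j.1.c.2 - σ.b j.1.n + σ.β j.1.n * |x - j.1.c.1|)),
        mul_nonneg (by linarith : (0:ℝ) ≤ z - x) (by linarith : (0:ℝ) ≤ j.2.c.2 + σ.b j.2.n
          - σ.β j.2.n * |y - j.2.c.1| - (j.1.c.2 - σ.b j.1.n + σ.β j.1.n * |y - j.1.c.1|))]
    nlinarith

/-- The left end of `jset`. [folklore] -/
def ja (σ : Scales) (j : Diamond × Diamond) : ℝ := sInf (jset σ j)

/-- The right end of `jset`. [folklore] -/
def jb (σ : Scales) (j : Diamond × Diamond) : ℝ := sSup (jset σ j)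

/-- A non-empty `jset` is the compact interval `[ja, jb]`. [folklore] -/
theorem mem_jset_iff_Icc {j : Diamond × Diamond} (hne : (jset σ j).Nonempty) {x : ℝ} :
    x ∈ jset σ j ↔ ja σ j ≤ x ∧ x ≤ jb σ j := by
  constructor
  · intro hx
    exact ⟨csInf_le (bddBelow_jset j) hx, le_csSup (bddAbove_jset j) hx⟩
  · rintro ⟨h1, h2⟩
    have ha : ja σ j ∈ jset σ j := (isClosed_jset j).csInf_mem hne (bddBelow_jset j)
    have hb : jb σ j ∈ jset σ j := (isClosed_jset j).csSup_mem hne (bddAbove_jset j)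
    exact jset_ordConnected j ha hb h1 h2

/-- `ja ≤ jb` for a non-empty `jset`. [folklore] -/
theorem ja_le_jb {j : Diamond × Diamond} (hne : (jset σ j).Nonempty) : ja σ j ≤ jb σ j :=
  csInf_le_csSup hne (bddBelow_jset j) (bddAbove_jset j)


/-! ### The envelope of a finite set of diamonds as a union of blobs -/

/-- The pairs of members whose support interval is non-empty. [folklore] -/
def jidx (σ : Scales) (S : Finset Diamond) : Finset (Diamond × Diamond) :=
  (S ×ˢ S).filter fun j => (jset σ j).Nonempty

/-- Membership in `jidx`. [folklore] -/
theorem mem_jidx {S : Finset Diamond} {j : Diamond × Diamond} :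
    j ∈ jidx σ S ↔ j.1 ∈ S ∧ j.2 ∈ S ∧ (jset σ j).Nonempty := by
  simp only [jidx, Finset.mem_filter, Finset.mem_product, and_assoc]

/-- The support intervals of `jidx` are genuine intervals. [folklore] -/
theorem hab_jidx (S : Finset Diamond) : ∀ j ∈ jidx σ S, ja σ j ≤ jb σ j :=
  fun _ hj => ja_le_jb (mem_jidx.mp hj).2.2

/-- Left end of the component of the support through the pair `i`. [folklore] -/
def pl (σ : Scales) (S : Finset Diamond) (i : Diamond × Diamond) : ℝ :=
  SafePaths.hullLeft (jidx σ S) (ja σ) (jb σ) i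

/-- Right end of the component of the support through the pair `i`. [folklore] -/
def pr (σ : Scales) (S : Finset Diamond) (i : Diamond × Diamond) : ℝ :=
  SafePaths.hullRight (jidx σ S) (ja σ) (jb σ) i

/-- `pl ≤ pr`. [folklore] -/
theorem pl_le_pr {S : Finset Diamond} {i : Diamond × Diamond} (hi : i ∈ jidx σ S) :
    pl σ S i ≤ pr σ S i :=
  (SafePaths.hullLeft_le hi (SafePaths.mem_cls_self hi)).trans
    ((hab_jidx S i hi).trans (SafePaths.le_hullRight hi (SafePaths.mem_cls_self hi)))

/-- Over a component the lower envelope is below the upper envelope: every abscissa of the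
component lies in some support interval of the class. [folklore] -/
theorem lfloor_le_uroof_of_mem {S : Finset Diamond} (hS : S.Nonempty) {i : Diamond × Diamond}
    (hi : i ∈ jidx σ S) {x : ℝ} (hx : pl σ S i ≤ x ∧ x ≤ pr σ S i) :
    lfloor σ S hS x ≤ uroof σ S hS x := by
  obtain ⟨j, hj, hjx⟩ := SafePaths.exists_mem_of_mem_hull (hab_jidx S) hi hx
  obtain ⟨hjI, -⟩ := SafePaths.mem_cls.mp hj
  obtain ⟨h1, h2, hne⟩ := mem_jidx.mp hjI
  have hxj : x ∈ jset σ j := (mem_jset_iff_Icc hne).mpr hjx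
  exact (lfloor_le_floor hS h1 x).trans (hxj.trans (roof_le_uroof hS h2 x))

/-- If the lower envelope is strictly below the upper envelope at `x`, then `x` is interior to
the support interval of the corresponding pair: that interval contains points on both sides.
[folklore] -/
theorem exists_jset_around {S : Finset Diamond} (hS : S.Nonempty) {x : ℝ}
    (hx : lfloor σ S hS x < uroof σ S hS x) :
    ∃ j ∈ jidx σ S, x ∈ jset σ j ∧ ∃ δ > 0, (x - δ) ∈ jset σ j ∧ (x + δ) ∈ jset σ j := by
  obtain ⟨F, hF, hFeq⟩ := exists_lfloor_eq (σ := σ) hS x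
  obtain ⟨F', hF', hF'eq⟩ := exists_uroof_eq (σ := σ) hS x
  set j : Diamond × Diamond := (F, F') with hj
  have hφx : F.floor σ x - F'.roof σ x < 0 := by rw [← hFeq, ← hF'eq]; linarith
  have hcont : Continuous fun t => F.floor σ t - F'.roof σ t :=
    F.continuous_floor.sub F'.continuous_roof
  have hev := (hcont.continuousAt (x := x)).eventually (gt_mem_nhds hφx)
  obtain ⟨δ, hδ, hδprop⟩ := Metric.eventually_nhds_iff.mp hev
  have hmem : ∀ t, dist t x < δ → t ∈ jset σ j := by
    intro t ht
    have := hδprop ht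
    rw [mem_jset]; simp only [hj]; linarith
  have hxj : x ∈ jset σ j := hmem x (by rw [dist_self]; exact hδ)
  refine ⟨j, mem_jidx.mpr ⟨hF, hF', ⟨x, hxj⟩⟩, hxj, δ / 2, by positivity, hmem _ ?_, hmem _ ?_⟩
  · rw [Real.dist_eq, show x - δ / 2 - x = -(δ / 2) by ring, abs_neg, abs_of_pos (by positivity)]
    linarith
  · rw [Real.dist_eq, show x + δ / 2 - x = δ / 2 by ring, abs_of_pos (by positivity)]
    linarith

/-- The component pinches at its left end. [folklore] -/
theorem pinch_pl {S : Finset Diamond} (hS : S.Nonempty) {i : Diamond × Diamond}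
    (hi : i ∈ jidx σ S) : lfloor σ S hS (pl σ S i) = uroof σ S hS (pl σ S i) := by
  refine le_antisymm (lfloor_le_uroof_of_mem hS hi ⟨le_rfl, pl_le_pr hi⟩) ?_
  by_contra hlt
  push Not at hlt
  obtain ⟨j, hj, hxj, δ, hδ, hleft, -⟩ := exists_jset_around hS hlt
  have hne := (mem_jidx.mp hj).2.2
  have h1 : ja σ j ≤ pl σ S i - δ := ((mem_jset_iff_Icc hne).mp hleft).1
  have h2 : pl σ S i ≤ jb σ j := ((mem_jset_iff_Icc hne).mp hxj).2
  have h3 := SafePaths.lt_hullLeft_of_lt (hab_jidx S) hi hj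
    (show ja σ j < SafePaths.hullLeft (jidx σ S) (ja σ) (jb σ) i by unfold pl at h1; linarith)
  unfold pl at h2
  linarith

/-- The component pinches at its right end. [folklore] -/
theorem pinch_pr {S : Finset Diamond} (hS : S.Nonempty) {i : Diamond × Diamond}
    (hi : i ∈ jidx σ S) : lfloor σ S hS (pr σ S i) = uroof σ S hS (pr σ S i) := by
  refine le_antisymm (lfloor_le_uroof_of_mem hS hi ⟨pl_le_pr hi, le_rfl⟩) ?_
  by_contra hlt
  push Not at hlt
  obtain ⟨j, hj, hxj, δ, hδ, -, hright⟩ := exists_jset_around hS hlt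
  have hne := (mem_jidx.mp hj).2.2
  have h1 : pr σ S i + δ ≤ jb σ j := ((mem_jset_iff_Icc hne).mp hright).2
  have h2 : ja σ j ≤ pr σ S i := ((mem_jset_iff_Icc hne).mp hxj).1
  have h3 := SafePaths.hullRight_lt_of_lt (hab_jidx S) hi hj
    (show SafePaths.hullRight (jidx σ S) (ja σ) (jb σ) i < jb σ j by unfold pr at h1; linarith)
  unfold pr at h2
  linarith

/-- A degenerate blob (a single point at the origin), used as a default value. [folklore] -/
def trivialBlob (K : ℝ≥0) : SafePaths.Blob K where
  l := 0
  r := 0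
  hlr := le_rfl
  top := fun _ => 0
  bot := fun _ => 0
  top_lip := (LipschitzWith.const 0).weaken bot_le
  bot_lip := (LipschitzWith.const 0).weaken bot_le
  bot_le_top := fun _ _ _ => le_rfl
  pinch_l := rfl
  pinch_r := rfl

/-- **The blob of the component through `i`** of the envelope of `S`: over
`[pl i, pr i]`, between the lower envelope of the floors and the upper envelope of the roofs
(`K` any common bound of the member slopes). [folklore] -/
def pieceBlob (S : Finset Diamond) (hS : S.Nonempty) (K : ℝ≥0) (hK : ∀ E ∈ S, σ.β E.n ≤ K)
    (i : Diamond × Diamond) : SafePaths.Blob K :=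
  if hi : i ∈ jidx σ S then
    { l := pl σ S i
      r := pr σ S i
      hlr := pl_le_pr hi
      top := uroof σ S hS
      bot := lfloor σ S hS
      top_lip := SafePaths.lip_iff.mpr (uroof_lip hS hK)
      bot_lip := SafePaths.lip_iff.mpr (lfloor_lip hS hK)
      bot_le_top := fun _ h1 h2 => lfloor_le_uroof_of_mem hS hi ⟨h1, h2⟩
      pinch_l := pinch_pl hS hi
      pinch_r := pinch_pr hS hi }
  else trivialBlob K

/-- Membership in the blob of a component. [folklore] -/
theorem mem_pieceBlob_iff {S : Finset Diamond} (hS : S.Nonempty) {K : ℝ≥0}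
    (hK : ∀ E ∈ S, σ.β E.n ≤ K) {i : Diamond × Diamond} (hi : i ∈ jidx σ S) {q : ℝ × ℝ} :
    q ∈ (pieceBlob S hS K hK i).toSet ↔
      pl σ S i ≤ q.1 ∧ q.1 ≤ pr σ S i ∧ lfloor σ S hS q.1 ≤ q.2 ∧ q.2 ≤ uroof σ S hS q.1 := by
  unfold pieceBlob
  rw [dif_pos hi]
  rfl

/-- **The envelope is the union of the blobs of its components.** [folklore] -/
theorem mem_env_iff_exists_pieceBlob {S : Finset Diamond} (hS : S.Nonempty) {K : ℝ≥0}
    (hK : ∀ E ∈ S, σ.β E.n ≤ K) {q : ℝ × ℝ} :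
    q ∈ env σ S ↔ ∃ i ∈ jidx σ S, q ∈ (pieceBlob S hS K hK i).toSet := by
  constructor
  · rintro ⟨⟨F, hF, hFq⟩, ⟨F', hF', hF'q⟩⟩
    set j : Diamond × Diamond := (F, F') with hj
    have hxj : q.1 ∈ jset σ j := by rw [mem_jset]; exact hFq.trans hF'q
    have hjI : j ∈ jidx σ S := mem_jidx.mpr ⟨hF, hF', ⟨q.1, hxj⟩⟩
    refine ⟨j, hjI, (mem_pieceBlob_iff hS hK hjI).mpr ⟨?_, ?_, ?_, ?_⟩⟩
    · exact (SafePaths.hullLeft_le hjI (SafePaths.mem_cls_self hjI)).trans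
        ((mem_jset_iff_Icc ⟨q.1, hxj⟩).mp hxj).1
    · exact ((mem_jset_iff_Icc ⟨q.1, hxj⟩).mp hxj).2.trans
        (SafePaths.le_hullRight hjI (SafePaths.mem_cls_self hjI))
    · exact (lfloor_le_floor hS hF q.1).trans hFq
    · exact hF'q.trans (roof_le_uroof hS hF' q.1)
  · rintro ⟨i, hi, hq⟩
    obtain ⟨-, -, h3, h4⟩ := (mem_pieceBlob_iff hS hK hi).mp hq
    exact (mem_env_iff_lfloor_uroof hS).mpr ⟨h3, h4⟩

/-- Blobs of components of one envelope are equal or disjoint. [folklore] -/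
theorem pieceBlob_eq_or_disjoint {S : Finset Diamond} (hS : S.Nonempty) {K : ℝ≥0}
    (hK : ∀ E ∈ S, σ.β E.n ≤ K) {i i' : Diamond × Diamond} (hi : i ∈ jidx σ S)
    (hi' : i' ∈ jidx σ S) :
    pieceBlob S hS K hK i = pieceBlob S hS K hK i' ∨
      Disjoint (pieceBlob S hS K hK i).toSet (pieceBlob S hS K hK i').toSet := by
  rcases SafePaths.linked_or_disjoint (hab_jidx S) hi hi' with hl | hd | hd
  · left
    obtain ⟨h1, h2⟩ := SafePaths.hull_eq_of_linked hi hi' hl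
    refine SafePaths.Blob.ext' ?_ ?_ ?_ ?_ <;> unfold pieceBlob <;> rw [dif_pos hi, dif_pos hi']
    · exact h1
    · exact h2
  · right
    rw [Set.disjoint_left]
    intro q hq hq'
    obtain ⟨-, h2, -, -⟩ := (mem_pieceBlob_iff hS hK hi).mp hq
    obtain ⟨h1', -, -, -⟩ := (mem_pieceBlob_iff hS hK hi').mp hq'
    unfold pr at h2; unfold pl at h1'
    linarith
  · right
    rw [Set.disjoint_left]
    intro q hq hq'
    obtain ⟨h1, -, -, -⟩ := (mem_pieceBlob_iff hS hK hi).mp hq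
    obtain ⟨-, h2', -, -⟩ := (mem_pieceBlob_iff hS hK hi').mp hq'
    unfold pl at h1; unfold pr at h2'
    linarith

/-! ### Safe points lie on safe flat paths -/

/-- The slope of level `0` as a non-negative real (the Lipschitz constant of the paths).
[cite: Hochman2025, Prop 4.1 (3)] -/
def K0 (σ : Scales) : ℝ≥0 := ⟨σ.β 0, (σ.β_pos 0).le⟩

/-- `K0` is `β₀`. [folklore] -/
@[simp] theorem coe_K0 : ((K0 σ : ℝ≥0) : ℝ) = σ.β 0 := rfl

/-- **Prop. 4.1 (3) / Prop. 4.9 (4) for the envelope hull: every safe point lies on a safe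
flat path.** For good scales and a `21`-sparse family, every `p ∈ safe F` lies on the graph of a
`β₀`-Lipschitz `f : ℝ → ℝ` (`β₀ = b₀ / a₀ = h₁ / w₁`, Hochman's `α₁`), `f p.1 = p.2`, all of whose
points are safe. (The hull is the disjoint union of the blobs of the components of the envelopes
of the root clans; apply `SafePaths.exists_path`.) [cite: Hochman2025, Prop 4.1 (3) and Prop 4.9 (4)] -/
theorem exists_safe_path {Λ : ℝ} (hσ : σ.Good Λ) {F : Finset Diamond} (hF : IsSparse σ F 21)
    {p : ℝ × ℝ} (hp : p ∈ safe σ F) :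
    ∃ f : ℝ → ℝ, LipschitzWith (K0 σ) f ∧ f p.1 = p.2 ∧ ∀ x, (x, f x) ∈ safe σ F := by
  have hK : ∀ D E, E ∈ clan σ F D → σ.β E.n ≤ (K0 σ : ℝ) := fun D E _ => hσ.β_le_β_zero E.n
  -- the blobs of the root pieces
  set roots := F.filter fun D => IsRoot σ F D with hroots
  have hne : ∀ D, (clan σ F D).Nonempty := fun D => ⟨D, self_mem_clan F D⟩
  set blobsOf : Diamond → Finset (SafePaths.Blob (K0 σ)) := fun D =>
    (jidx σ (clan σ F D)).image (pieceBlob (clan σ F D) (hne D) (K0 σ) (hK D)) with hblobsOf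
  set 𝔅 : Finset (SafePaths.Blob (K0 σ)) := roots.biUnion blobsOf with h𝔅
  -- membership bookkeeping
  have hmem𝔅 : ∀ B ∈ 𝔅, ∃ D, IsRoot σ F D ∧ ∃ i ∈ jidx σ (clan σ F D),
      B = pieceBlob (clan σ F D) (hne D) (K0 σ) (hK D) i := by
    intro B hB
    obtain ⟨D, hD, hBD⟩ := Finset.mem_biUnion.mp hB
    obtain ⟨i, hi, rfl⟩ := Finset.mem_image.mp hBD
    exact ⟨D, (Finset.mem_filter.mp hD).2, i, hi, rfl⟩
  have hsub : ∀ B ∈ 𝔅, ∃ D, IsRoot σ F D ∧ B.toSet ⊆ env σ (clan σ F D) := by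
    intro B hB
    obtain ⟨D, hD, i, hi, rfl⟩ := hmem𝔅 B hB
    exact ⟨D, hD, fun q hq => (mem_env_iff_exists_pieceBlob (hne D) (hK D)).mpr ⟨i, hi, hq⟩⟩
  -- pairwise disjointness
  have hdisj : ∀ B ∈ 𝔅, ∀ B' ∈ 𝔅, B ≠ B' → Disjoint B.toSet B'.toSet := by
    intro B hB B' hB' hBB'
    obtain ⟨D, hD, i, hi, rfl⟩ := hmem𝔅 B hB
    obtain ⟨D', hD', i', hi', rfl⟩ := hmem𝔅 B' hB'
    by_cases hDD' : D = D'
    · subst hDD'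
      rcases pieceBlob_eq_or_disjoint (hne D) (hK D) hi hi' with h | h
      · exact absurd h hBB'
      · exact h
    · rw [Set.disjoint_left]
      intro q hq hq'
      have h1 : q ∈ env σ (clan σ F D) := (mem_env_iff_exists_pieceBlob (hne D) (hK D)).mpr ⟨i, hi, hq⟩
      have h2 : q ∈ env σ (clan σ F D') :=
        (mem_env_iff_exists_pieceBlob (hne D') (hK D')).mpr ⟨i', hi', hq'⟩
      have := sep_of_isRoot hσ hF hD hD' hDD' q h1 q h2
      rw [dist_self] at this
      linarith [σ.b_pos (min D.n D'.n)]
  -- `p` is outside all blobs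
  have hpout : ∀ B ∈ 𝔅, p ∉ B.toSet := by
    intro B hB hpB
    obtain ⟨D, hD, hBsub⟩ := hsub B hB
    exact (mem_safe_iff_forall_root.mp hp) D hD (hBsub hpB)
  obtain ⟨f, hflip, hfp, hfsafe⟩ :=
    SafePaths.exists_path (le_refl (K0 σ)) (by rw [coe_K0]; exact σ.β_pos 0) 𝔅 hdisj p hpout
  refine ⟨f, hflip, hfp, fun x => ?_⟩
  rw [mem_safe_iff_forall_root]
  intro D hD hxD
  obtain ⟨i, hi, hq⟩ := (mem_env_iff_exists_pieceBlob (hne D) (hK D)).mp hxD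
  have hB : pieceBlob (clan σ F D) (hne D) (K0 σ) (hK D) i ∈ 𝔅 := by
    refine Finset.mem_biUnion.mpr ⟨D, Finset.mem_filter.mpr ⟨hD.1, hD⟩, ?_⟩
    exact Finset.mem_image_of_mem _ hi
  exact hfsafe x _ hB hq


/-! ### Prop. 4.1 for families of rectangles (§4.5 "Application to rectangles") -/

/-- The dimensions of a multi-scale family of rectilinear rectangles: level-`n` rectangles have
width `w n` and height `h n` (Prop. 4.1: "`R_n` an 80-sparse collection of rectilinear
rectangles of dimensions `w_n × h_n`"). [cite: Hochman2025, Prop 4.1] -/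
structure RectScales where
  /-- width of level-`n` rectangles -/
  w : ℕ → ℝ
  /-- height of level-`n` rectangles -/
  h : ℕ → ℝ
  w_pos : ∀ n, 0 < w n
  h_pos : ∀ n, 0 < h n

namespace RectScales

/-- The scales of the associated diamonds `◇(2R)` (§4.5: "`◇(R)` denotes the closed diamond of
dimensions `2w × 2h` with the same center as `R` ... that contains `R`"; so `◇(2R)` has
half-width `2 w` and half-height `2 h`). [cite: Hochman2025, §4.5] -/
def toScales (ρ : RectScales) : Scales where
  a n := 2 * ρ.w n
  b n := 2 * ρ.h n
  a_pos n := by have := ρ.w_pos n; positivity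
  b_pos n := by have := ρ.h_pos n; positivity

/-- The slope of the associated diamonds is `h / w`. [folklore] -/
theorem β_toScales (ρ : RectScales) (n : ℕ) : ρ.toScales.β n = ρ.h n / ρ.w n := by
  simp only [Scales.β, toScales]
  field_simp

end RectScales

/-- A rectangle is given, like a diamond, by its centre and its level; `D.rect ρ K` is the scaled
rectangle `K·R` (same centre, dimensions `K w × K h`; §4.1 "`cE`"). [cite: Hochman2025, §4.1] -/
def Diamond.rect (ρ : RectScales) (D : Diamond) (K : ℝ) : Set (ℝ × ℝ) :=
  {q | |q.1 - D.c.1| ≤ K * ρ.w D.n / 2 ∧ |q.2 - D.c.2| ≤ K * ρ.h D.n / 2}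

/-- Membership in a scaled rectangle. [folklore] -/
theorem Diamond.mem_rect {ρ : RectScales} {D : Diamond} {K : ℝ} {q : ℝ × ℝ} :
    q ∈ D.rect ρ K ↔ |q.1 - D.c.1| ≤ K * ρ.w D.n / 2 ∧ |q.2 - D.c.2| ≤ K * ρ.h D.n / 2 := Iff.rfl

/-- `2R ⊆ ◇(2R)`: the doubled rectangle lies in the associated diamond. [cite: Hochman2025, §4.5] -/
theorem Diamond.rect_two_subset_toSet (ρ : RectScales) (D : Diamond) :
    D.rect ρ 2 ⊆ D.toSet ρ.toScales := by
  intro q hq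
  rw [Diamond.mem_rect] at hq
  rw [Diamond.mem_toSet_iff]
  simp only [RectScales.toScales]
  have hw := ρ.w_pos D.n
  have hh := ρ.h_pos D.n
  nlinarith [hq.1, hq.2, abs_nonneg (q.1 - D.c.1), abs_nonneg (q.2 - D.c.2)]

/-- `K·◇(2R) ⊆ (4K)·R`: a scaled associated diamond lies in a scaled rectangle.
[cite: Hochman2025, §4.5] -/
theorem Diamond.scaled_subset_rect (ρ : RectScales) (D : Diamond) (K : ℝ) :
    D.scaled ρ.toScales K ⊆ D.rect ρ (4 * K) := by
  intro q hq
  rw [Diamond.scaled, mem_setOf_eq, gauge_le_iff] at hq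
  simp only [RectScales.toScales, Prod.fst_sub, Prod.snd_sub] at hq
  rw [Diamond.mem_rect]
  have hw := ρ.w_pos D.n
  have hh := ρ.h_pos D.n
  constructor
  · -- drop the (non-negative) second term
    have h1 : 2 * ρ.h D.n * |q.1 - D.c.1| ≤ K * (2 * ρ.w D.n * (2 * ρ.h D.n)) := by
      nlinarith [abs_nonneg (q.2 - D.c.2)]
    have h2 : |q.1 - D.c.1| ≤ K * (2 * ρ.w D.n) := by
      have : 2 * ρ.h D.n * |q.1 - D.c.1| ≤ 2 * ρ.h D.n * (K * (2 * ρ.w D.n)) := by nlinarith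
      exact le_of_mul_le_mul_left this (by positivity)
    nlinarith
  · have h1 : 2 * ρ.w D.n * |q.2 - D.c.2| ≤ K * (2 * ρ.w D.n * (2 * ρ.h D.n)) := by
      nlinarith [abs_nonneg (q.1 - D.c.1)]
    have h2 : |q.2 - D.c.2| ≤ K * (2 * ρ.h D.n) := by
      have : 2 * ρ.w D.n * |q.2 - D.c.2| ≤ 2 * ρ.w D.n * (K * (2 * ρ.h D.n)) := by nlinarith
      exact le_of_mul_le_mul_left this (by positivity)
    nlinarith

/-- **Sparsity of a rectangle family**: distinct rectangles of the same level `n` have centres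
separated by `≥ 42 wₙ` horizontally or by `≥ 42 hₙ` vertically (this is implied by Hochman's
"`84`-sparse" in the sense of §4.1 and implies `21`-sparsity of the associated diamonds).
[cite: Hochman2025, §4.1 and Prop 4.1] -/
def RectSparse (ρ : RectScales) (F : Finset Diamond) : Prop :=
  ∀ D ∈ F, ∀ D' ∈ F, D ≠ D' → D.n = D'.n →
    42 * ρ.w D.n ≤ |D.c.1 - D'.c.1| ∨ 42 * ρ.h D.n ≤ |D.c.2 - D'.c.2|

/-- A sparse rectangle family has a `21`-sparse family of associated diamonds. [folklore] -/
theorem RectSparse.isSparse {ρ : RectScales} {F : Finset Diamond} (hF : RectSparse ρ F) :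
    IsSparse ρ.toScales F 21 := by
  intro D hD D' hD' hne hn
  rw [le_gauge_iff]
  simp only [RectScales.toScales, Prod.fst_sub, Prod.snd_sub]
  have hw := ρ.w_pos D.n
  have hh := ρ.h_pos D.n
  rcases hF D hD D' hD' hne hn with h | h
  · nlinarith [abs_nonneg (D.c.2 - D'.c.2)]
  · nlinarith [abs_nonneg (D.c.1 - D'.c.1)]

/-- The path slope `K0` of the associated scales is `h₀ / w₀` (Hochman's `h₁ / w₁`, levels being
indexed from `0` here). [cite: Hochman2025, Prop 4.1 (3)] -/
theorem coe_K0_toScales (ρ : RectScales) : ((K0 ρ.toScales : ℝ≥0) : ℝ) = ρ.h 0 / ρ.w 0 := by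
  rw [coe_K0, RectScales.β_toScales]

/-- **Hochman 2025, Proposition 4.1 (safe points relative to a sparse multi-scale family of
rectangles)**, for the envelope-hull safe set `safe ρ.toScales F` of the associated diamonds
`◇(2R)` (with `wₙ ≥ Λ hₙ`, `hₙ₊₁ ≥ Λ wₙ`, slopes decreasing by `Λ`, `Λ ≥ 10`; sparsity as in
`RectSparse`; all distances in the sup-metric of `ℝ²`):
(1) every point outside all `8R` is safe, and no point of any `2R` is
    (Hochman: sandwich between `ℝ² ∖ ⋃ 20R` and `ℝ² ∖ ⋃ 2R`);
(2) every vertical segment of length `8 h_N` contains a safe point, if all levels are `≤ N`;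
(3) every safe point lies on the graph of an `(h₀/w₀)`-Lipschitz function all of whose points
    are safe;
(4) if `F'` is another family such that every rectangle `R' ∈ F'` with `p ∈ 76 R'` belongs to
    `F`, then `p ∈ safe(F)` implies `p ∈ safe(F')` (Hochman: agreement on `{R | p ∈ 40R}`; in
    particular safety is antitone in the family and local under far additions).
[cite: Hochman2025, Prop 4.1] -/
theorem prop_4_1 {ρ : RectScales} {Λ : ℝ} (hρ : ρ.toScales.Good Λ) {F : Finset Diamond}
    (hF : RectSparse ρ F) :
    ((⋃ D ∈ F, D.rect ρ 8)ᶜ ⊆ safe ρ.toScales F ∧ ∀ D ∈ F, safe ρ.toScales F ∩ D.rect ρ 2 = ∅) ∧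
    (∀ N : ℕ, (∀ D ∈ F, D.n ≤ N) → ∀ x u : ℝ,
      ∃ y ∈ Icc u (u + 8 * ρ.h N), (x, y) ∈ safe ρ.toScales F) ∧
    (∀ p ∈ safe ρ.toScales F, ∃ f : ℝ → ℝ, LipschitzWith (K0 ρ.toScales) f ∧ f p.1 = p.2 ∧
      ∀ x, (x, f x) ∈ safe ρ.toScales F) ∧
    (∀ (F' : Finset Diamond) (p : ℝ × ℝ), (∀ D ∈ F', p ∈ D.rect ρ 76 → D ∈ F) →
      p ∈ safe ρ.toScales F → p ∈ safe ρ.toScales F') := by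
  set σ := ρ.toScales with hσdef
  have hsparse : IsSparse σ F 21 := hF.isSparse
  refine ⟨⟨?_, ?_⟩, ?_, ?_, ?_⟩
  · -- (1), left: outside all `8R` ⇒ outside all `2·◇(2R)` ⇒ safe
    intro p hp
    apply compl_iUnion_scaled_subset_safe hρ F
    simp only [mem_compl_iff, mem_iUnion, exists_prop, not_exists, not_and] at hp ⊢
    intro D hD hpD
    have := Diamond.scaled_subset_rect ρ D 2 hpD
    norm_num at this
    exact hp D hD this
  · -- (1), right: `2R ⊆ ◇(2R)` is inside the hull
    intro D hD
    ext q
    simp only [mem_inter_iff, mem_empty_iff_false, iff_false, not_and]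
    intro hq hqR
    have := safe_inter_toSet (σ := σ) hD
    rw [Set.eq_empty_iff_forall_notMem] at this
    exact this q ⟨hq, Diamond.rect_two_subset_toSet ρ D hqR⟩
  · -- (2): `4 b_N = 8 h_N`
    intro N hN x u
    obtain ⟨y, hy, hsafe⟩ := exists_safe_on_vertical hρ hsparse hN x u
    refine ⟨y, ?_, hsafe⟩
    simpa [hσdef, RectScales.toScales, show (4:ℝ) * (2 * ρ.h N) = 8 * ρ.h N by ring] using hy
  · -- (3)
    intro p hp
    exact exists_safe_path hρ hsparse hp
  · -- (4): gauge `≤ 19` means inside `19·◇(2R) ⊆ 76 R`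
    intro F' p hagree hp
    refine safe_of_near_mem hρ (fun D hD hle => hagree D hD ?_) hp
    have h19 : p ∈ D.scaled σ 19 := hle
    have := Diamond.scaled_subset_rect ρ D 19 h19
    norm_num at this
    exact this

end SafePoints

end Hochman2025

end Literature.Dynamics.SymbolicDynamics
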